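import Mathlib.Analysis.SpecialFunctions.Integrals.Basic
import Mathlib.Analysis.SpecialFunctions.Pow.Real
import Mathlib.Analysis.SpecialFunctions.Log.Basic
import Mathlib.Analysis.Real.Pi.Bounds
import Mathlib.Analysis.Complex.ExponentialBounds
import Literature.Analysis.FluidPDE.ElgindiProfileNontrivial
import HarnessLib

/-!
# Numerical facts on Elgindi's kernel `K`, angular weight `Γ` and constant `c` behind the
weighted-`L²` coercivity of `𝓛_Γ`

Topic `Literature/Analysis/FluidPDE`. Support file (everything proved, no definitions, no named
facts) on the proof path of the named fact
`Literature.Analysis.FluidPDE.Elgindi.ElgindiGhoulMasmoudi2021_stabilityCore`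
(`ElgindiStabilityDecomposition.lean`). The weighted `L²` coercivity of the linearised fundamental
model, T. M. Elgindi, Ann. of Math. 194 (2021) = arXiv:1904.04795 (`[Elgindi2021]`), §5
Proposition 5.5 (`(𝓛_Γ(f)w, fw)_{L²} ≥ ¼|fw|²_{L²}`, p. 15 of the held text; the base case of the
`𝓗ᵏ` coercivity of Elgindi–Ghoul–Masmoudi, Camb. J. Math. 9 (2021), Prop. 3.2) rests on one
numerical input about the angular functions `K(θ) = 3 sin θ cos²θ`, `Γ(θ) = (sin θ cos²θ)^{α/3}`,
`c = ∫₀^{π/2} KΓ` (`Elgindi.kernelK`, `Elgindi.angularWeight`, `Elgindi.profileConst` of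
`ElgindiFundamentalModel.lean`), the display (GammaAssumption) of §5, p. 15:
"`|Γ/c − K|_{L²[0,π/2]} ≤ 7/10`. Recall that `Γ` takes the form `(sin θ cos²θ)^β` for some
`0 ≤ β ≤ 1`. The fact that such examples actually satisfy this assumption is a simple exercise",
used in the proof of Prop. 5.5 through "Since `(7/5)² < 4(¼)(2)`".

## What is proved, and the (documented) deviation from the printed constant

For the profile only small `α` matters (`β = α/3`; the theorems are for `0 < α < α₀`). At `β = 0`
one has `Γ ≡ 1`, `c = ∫K = 1` and `|1 − K|²_{L²} = 25π/32 − 2 ≈ 0.4544 = (0.674)²`, inside the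
printed `7/10` by a margin of `0.026` only, which a perturbation argument in `β` with elementary
explicit constants does not comfortably fit. The proof of Prop. 5.5 vendored in the sequel
(`ElgindiL2Coercivity.lean`) therefore splits `Γ/c = λK + R` with `λ = 7/5` instead of the
printed `λ = 1`; the exact-derivative part scales by `λ` and the sufficient condition becomes
`|R|²_{L²} = |Γ/c − (7/5)K|²_{L²} ≤ λ/2 = 7/10`, which holds with room: since
`(Γ/c, K)_{L²} = 1` exactly, `|Γ/c − λK|² = |Γ|²/c² − 2λ + λ²|K|²`, and `|Γ|² ≤ π/2`,
`|K|² = 9π/32`, `c ≥ 49/50` give `≤ 0.57`. This file proves exactly these inputs: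

* `integral_kernelK_sq`: **`∫₀^{π/2} K² = 9π/32`** (`sin²cos⁴ = cos⁴ − cos⁶` and the reduction
  formula for `∫cosⁿ`), also over `Ioo 0 (π/2)`;
* `angularWeight_le_one`: `Γ ≤ 1` on `[0, π/2]` (`α ≥ 0`);
* `profileConst_ge`: **`c_α ≥ 49/50` for `0 ≤ α ≤ 1/200`** (pointwise
  `KΓ ≥ t^β(K − 3t)` with `t = 10⁻³`, `t^β ≥ 1 − 7β` from `e⁷ > 10³`, `∫K = 1`, `π < 3.1416`);
* `integral_kernelK_mul_angularWeight_div` : `∫₀^{π/2} (Γ/c)K = 1`;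
* **`integral_sq_angularWeight_div_sub_le`**: `∫₀^{π/2} (Γ/c − (7/5)K)² dθ ≤ 7/10` for
  `0 ≤ α ≤ 1/200` — the form consumed by the coercivity proof.

The printed (GammaAssumption) with constant `7/10` and `λ = 1` is *not* claimed here.

Used from Mathlib: `integral_cos_pow`, `integral_cos_sq`, `Real.rpow_le_rpow`,
`Real.rpow_def_of_pos`, `Real.add_one_le_exp`, `Real.exp_one_gt_d9`, `Real.pi_lt_d4`,
`Real.pi_gt_d2`, `intervalIntegral.integral_mono_on`.
-/

noncomputable section

open MeasureTheory Set Real intervalIntegral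

namespace Literature.Analysis.FluidPDE

namespace Elgindi

/-! ### `∫₀^{π/2} K² = 9π/32` -/

/-- `∫₀^{π/2} cos⁴ = 3π/16`. [folklore] -/
theorem integral_cos_pow_four : ∫ x in (0 : ℝ)..(π / 2), Real.cos x ^ 4 = 3 * π / 16 := by
  have h := integral_cos_pow (a := 0) (b := π / 2) (n := 2)
  rw [h, integral_cos_sq]
  simp
  ring

/-- `∫₀^{π/2} cos⁶ = 5π/32`. [folklore] -/
theorem integral_cos_pow_six : ∫ x in (0 : ℝ)..(π / 2), Real.cos x ^ 6 = 5 * π / 32 := by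
  have h := integral_cos_pow (a := 0) (b := π / 2) (n := 4)
  rw [h, integral_cos_pow_four]
  simp
  ring

/-- **`|K|²_{L²[0,π/2]} = 9π/32`**: `∫₀^{π/2} (3 sin θ cos²θ)² dθ = 9∫₀^{π/2}(cos⁴θ − cos⁶θ) dθ =
9(3π/16 − 5π/32)` (the constant `|K|_{L²} < 1` used in the proofs of [Elgindi2021] Lemma 5.4,
"`≤ (2/3)|K|_{L²}|z⁻²L₁₂(f)|_{L²}|z⁻²f|_{L²} < (2/3)|z⁻²L₁₂(f)||z⁻²f|`", and Prop. 5.5). [folklore] -/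
theorem integral_kernelK_sq : ∫ θ in (0 : ℝ)..(π / 2), kernelK θ ^ 2 = 9 * π / 32 := by
  have e : ∀ θ : ℝ, kernelK θ ^ 2 = 9 * (Real.cos θ ^ 4 - Real.cos θ ^ 6) := by
    intro θ
    simp only [kernelK]
    have := Real.sin_sq_add_cos_sq θ
    linear_combination (9 * Real.cos θ ^ 4) * this
  simp_rw [e]
  rw [intervalIntegral.integral_const_mul, intervalIntegral.integral_sub
    (by apply Continuous.intervalIntegrable; fun_prop)
    (by apply Continuous.intervalIntegrable; fun_prop), integral_cos_pow_four,
    integral_cos_pow_six]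
  ring

/-- `∫_{(0,π/2)} K² = 9π/32`, set-integral form. [folklore] -/
theorem setIntegral_kernelK_sq : ∫ θ in Ioo 0 (π / 2), kernelK θ ^ 2 = 9 * π / 32 := by
  rw [← integral_kernelK_sq, intervalIntegral.integral_of_le (by positivity),
    integral_Ioc_eq_integral_Ioo]

/-- `∫_{(0,π/2)} K = 1`, set-integral form of `integral_kernelK`. [folklore] -/
theorem setIntegral_kernelK : ∫ θ in Ioo 0 (π / 2), kernelK θ = 1 := by
  rw [← integral_kernelK, intervalIntegral.integral_of_le (by positivity),
    integral_Ioc_eq_integral_Ioo]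

/-! ### `Γ ≤ 1` and `(Γ/c, K) = 1` -/

/-- `sin θ cos²θ ≤ 1`. [folklore] -/
theorem sin_mul_cos_sq_le_one (θ : ℝ) : Real.sin θ * Real.cos θ ^ 2 ≤ 1 := by
  have h1 : Real.sin θ ≤ 1 := Real.sin_le_one θ
  have h2 : Real.cos θ ^ 2 ≤ 1 := by nlinarith [Real.cos_sq_le_one θ]
  nlinarith [sq_nonneg (Real.cos θ), Real.neg_one_le_sin θ]

/-- **`Γ ≤ 1` on the closed quarter** (`α ≥ 0`): `Γ = x^{α/3}` with `0 ≤ x = sin θ cos²θ ≤ 1`. [folklore] -/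
theorem angularWeight_le_one {α : ℝ} (hα : 0 ≤ α) {θ : ℝ} (hθ : θ ∈ Icc 0 (π / 2)) :
    angularWeight α θ ≤ 1 :=
  Real.rpow_le_one (sin_mul_cos_sq_nonneg hθ) (sin_mul_cos_sq_le_one θ) (div_nonneg hα zero_le_three)

/-- **`(Γ/c, K)_{L²[0,π/2]} = 1`**: `∫₀^{π/2} (Γ/c)K = c/c` by the definition of `c` (`α ≥ 0`). [folklore] -/
theorem setIntegral_kernelK_mul_angularWeight_div {α : ℝ} (hα : 0 ≤ α) :
    ∫ θ in Ioo 0 (π / 2), kernelK θ * (angularWeight α θ / profileConst α) = 1 := by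
  have hc : profileConst α ≠ 0 := (profileConst_pos hα).ne'
  have e : ∀ θ, kernelK θ * (angularWeight α θ / profileConst α) =
      (kernelK θ * angularWeight α θ) / profileConst α := fun θ => by ring
  simp_rw [e]
  rw [MeasureTheory.integral_div, ← profileConst_eq_setIntegral, div_self hc]

/-! ### `c_α ≥ 49/50` for `0 ≤ α ≤ 1/200` -/

/-- `e⁷ > 1000`, hence `log 1000 ≤ 7`. [folklore] -/
theorem log_thousand_le_seven : Real.log 1000 ≤ 7 := by
  rw [Real.log_le_iff_le_exp (by norm_num)]
  have h1 : (2.7 : ℝ) < Real.exp 1 := lt_trans (by norm_num) Real.exp_one_gt_d9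
  have h7 : Real.exp 1 ^ 7 = Real.exp 7 := by
    rw [Real.exp_one_pow]
    norm_num
  rw [← h7]
  have h27 : (2.7 : ℝ) ^ 7 ≤ Real.exp 1 ^ 7 :=
    pow_le_pow_left₀ (by norm_num) h1.le 7
  have h10 : (1000 : ℝ) ≤ (2.7 : ℝ) ^ 7 := by norm_num
  exact h10.trans h27

/-- **`t^β ≥ 1 − 7β`** for `t = 10⁻³` and `β ≥ 0`: `t^β = e^{β log t} ≥ 1 + β log t ≥ 1 − 7β`. [folklore] -/
theorem thousandth_rpow_ge {β : ℝ} (hβ : 0 ≤ β) : 1 - 7 * β ≤ (1 / 1000 : ℝ) ^ β := by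
  have ht : (0 : ℝ) < 1 / 1000 := by norm_num
  rw [Real.rpow_def_of_pos ht]
  have hlog : -7 ≤ Real.log (1 / 1000 : ℝ) := by
    rw [one_div, Real.log_inv]
    linarith [log_thousand_le_seven]
  have h1 : -7 * β ≤ Real.log (1 / 1000 : ℝ) * β := mul_le_mul_of_nonneg_right hlog hβ
  have h2 := Real.add_one_le_exp (Real.log (1 / 1000 : ℝ) * β)
  linarith

/-- **Pointwise lower bound `KΓ ≥ t^β(K − 3t)`** on `[0, π/2]`, for `t > 0`, `β = α/3 ≥ 0`:
with `x = sin θ cos²θ`, `K = 3x`, `Γ = x^β`; if `x ≥ t` then `x^β ≥ t^β`, else the right side is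
negative. [folklore] -/
theorem kernelK_mul_angularWeight_ge {α t : ℝ} (hα : 0 ≤ α) (ht : 0 < t) {θ : ℝ}
    (hθ : θ ∈ Icc 0 (π / 2)) :
    t ^ (α / 3) * (kernelK θ - 3 * t) ≤ kernelK θ * angularWeight α θ := by
  set x : ℝ := Real.sin θ * Real.cos θ ^ 2 with hx
  have hx0 : 0 ≤ x := sin_mul_cos_sq_nonneg hθ
  have hβ : 0 ≤ α / 3 := div_nonneg hα zero_le_three
  have hK : kernelK θ = 3 * x := by simp [kernelK, hx]; ring
  have hΓ : angularWeight α θ = x ^ (α / 3) := rfl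
  have htβ : 0 ≤ t ^ (α / 3) := Real.rpow_nonneg ht.le _
  rw [hK, hΓ]
  rcases le_or_gt t x with htx | htx
  · have h1 : t ^ (α / 3) ≤ x ^ (α / 3) := Real.rpow_le_rpow ht.le htx hβ
    have h2 : 0 ≤ 3 * x - 3 * t := by linarith
    calc t ^ (α / 3) * (3 * x - 3 * t) ≤ x ^ (α / 3) * (3 * x - 3 * t) :=
          mul_le_mul_of_nonneg_right h1 h2
      _ ≤ x ^ (α / 3) * (3 * x) := by
          have : 0 ≤ x ^ (α / 3) := Real.rpow_nonneg hx0 _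
          nlinarith
      _ = 3 * x * x ^ (α / 3) := by ring
  · have h1 : t ^ (α / 3) * (3 * x - 3 * t) ≤ 0 :=
      mul_nonpos_of_nonneg_of_nonpos htβ (by linarith)
    have h2 : 0 ≤ 3 * x * x ^ (α / 3) := by
      have : 0 ≤ x ^ (α / 3) := Real.rpow_nonneg hx0 _
      positivity
    linarith

/-- **`c_α ≥ 49/50` for `0 ≤ α ≤ 1/200`**: integrating `KΓ ≥ t^β(K − 3t)` (`t = 10⁻³`) over
`[0, π/2]` gives `c ≥ t^β(∫K − 3tπ/2) = t^β(1 − 3π/2000) ≥ (1 − 7/600)(1 − 3π/2000)` (Elgindi 2021,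
§1.7.1 records `1/10 ≤ c ≤ 10`; for the coercivity constant we need `c` close to `1`). [folklore] -/
theorem profileConst_ge {α : ℝ} (hα : 0 ≤ α) (hα' : α ≤ 1 / 200) : (49 / 50 : ℝ) ≤ profileConst α := by
  set t : ℝ := 1 / 1000 with ht
  have ht0 : (0 : ℝ) < t := by norm_num [ht]
  have hβ : 0 ≤ α / 3 := div_nonneg hα zero_le_three
  -- integrate the pointwise bound
  have hmono : ∫ θ in (0 : ℝ)..(π / 2), t ^ (α / 3) * (kernelK θ - 3 * t) ≤ profileConst α := by
    unfold profileConst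
    refine intervalIntegral.integral_mono_on (by positivity) ?_
      ((continuous_kernelK_mul_angularWeight hα).intervalIntegrable _ _) fun θ hθ =>
      kernelK_mul_angularWeight_ge hα ht0 hθ
    apply Continuous.intervalIntegrable
    exact continuous_const.mul (continuous_kernelK.sub continuous_const)
  have hK3 : ∫ θ in (0 : ℝ)..(π / 2), (kernelK θ - 3 * t) = 1 - 3 * t * (π / 2) := by
    rw [intervalIntegral.integral_sub (continuous_kernelK.intervalIntegrable _ _) (by simp),
      integral_kernelK, intervalIntegral.integral_const, smul_eq_mul, sub_zero]
    ring
  have hval : ∫ θ in (0 : ℝ)..(π / 2), t ^ (α / 3) * (kernelK θ - 3 * t) =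
      t ^ (α / 3) * (1 - 3 * t * (π / 2)) := by
    rw [intervalIntegral.integral_const_mul, hK3]
  rw [hval] at hmono
  -- numerics: `t^β ≥ 1 − 7β ≥ 1 − 7/600`, `1 − 3tπ/2 ≥ 1 − 3·3.1416/2000`
  have h1 : 1 - 7 * (α / 3) ≤ t ^ (α / 3) := thousandth_rpow_ge hβ
  have h2 : (0 : ℝ) < 1 - 3 * t * (π / 2) := by
    have := Real.pi_lt_d4
    norm_num [ht]
    nlinarith
  have h3 : (1 - 7 * (α / 3)) * (1 - 3 * t * (π / 2)) ≤ t ^ (α / 3) * (1 - 3 * t * (π / 2)) :=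
    mul_le_mul_of_nonneg_right h1 h2.le
  have h4 : (49 / 50 : ℝ) ≤ (1 - 7 * (α / 3)) * (1 - 3 * t * (π / 2)) := by
    have hπ := Real.pi_lt_d4
    norm_num [ht]
    nlinarith
  linarith

/-! ### The input of the coercivity proof: `|Γ/c − (7/5)K|²_{L²} ≤ 7/10` -/

/-- **`∫₀^{π/2} (Γ/c − (7/5)K)² dθ ≤ 7/10` for `0 ≤ α ≤ 1/200`** — the form of [Elgindi2021]
(GammaAssumption) ("`|Γ/c − K|_{L²} ≤ 7/10`", §5, p. 15) used by the vendored proof of Prop. 5.5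
with the splitting constant `λ = 7/5` (see the module docstring): expanding,
`∫(Γ/c − λK)² = ∫Γ²/c² − 2λ∫(Γ/c)K + λ²∫K² = ∫Γ²/c² − 2λ + λ²·9π/32 ≤ (π/2)(50/49)² − 14/5 +
(49/25)(9π/32) < 0.57`. [cite: Elgindi2021, §5 (GammaAssumption) and proof of Proposition 5.5 (p. 15 of arXiv:1904.04795)] -/
theorem integral_sq_angularWeight_div_sub_le {α : ℝ} (hα : 0 ≤ α) (hα' : α ≤ 1 / 200) :
    ∫ θ in Ioo 0 (π / 2), (angularWeight α θ / profileConst α - 7 / 5 * kernelK θ) ^ 2 ≤ 7 / 10 := by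
  set c := profileConst α with hc
  have hcpos : 0 < c := profileConst_pos hα
  have hc49 : (49 / 50 : ℝ) ≤ c := profileConst_ge hα hα'
  have hΓc : Continuous (angularWeight α) := continuous_angularWeight hα
  -- integrability on the finite interval of the three continuous pieces
  have hI : ∀ {g : ℝ → ℝ}, Continuous g → IntegrableOn g (Ioo 0 (π / 2)) := fun hg =>
    (hg.integrableOn_Icc (a := 0) (b := π / 2)).mono_set Ioo_subset_Icc_self
  have i1 : IntegrableOn (fun θ => (angularWeight α θ / c) ^ 2) (Ioo 0 (π / 2)) := hI (by fun_prop)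
  have i2 : IntegrableOn (fun θ => kernelK θ * (angularWeight α θ / c)) (Ioo 0 (π / 2)) :=
    hI (continuous_kernelK.mul (hΓc.div_const _))
  have i3 : IntegrableOn (fun θ => kernelK θ ^ 2) (Ioo 0 (π / 2)) := hI (continuous_kernelK.pow 2)
  -- expand the square
  have e : ∀ θ, (angularWeight α θ / c - 7 / 5 * kernelK θ) ^ 2 =
      (angularWeight α θ / c) ^ 2 - (14 / 5) * (kernelK θ * (angularWeight α θ / c)) +
        (49 / 25) * kernelK θ ^ 2 := fun θ => by ring
  simp_rw [e]
  have hsplit : ∫ θ in Ioo 0 (π / 2), ((angularWeight α θ / c) ^ 2 -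
      (14 / 5) * (kernelK θ * (angularWeight α θ / c)) + (49 / 25) * kernelK θ ^ 2) =
      (∫ θ in Ioo 0 (π / 2), (angularWeight α θ / c) ^ 2) - 14 / 5 * 1 + 49 / 25 * (9 * π / 32) := by
    rw [MeasureTheory.integral_add, MeasureTheory.integral_sub, MeasureTheory.integral_const_mul,
      MeasureTheory.integral_const_mul, setIntegral_kernelK_mul_angularWeight_div hα,
      setIntegral_kernelK_sq]
    all_goals first
      | exact i1.sub (i2.const_mul _)
      | exact i3.const_mul _
      | exact i2.const_mul _
      | exact i1
  rw [hsplit]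
  -- `∫ (Γ/c)² ≤ (π/2)/c²` since `Γ ≤ 1`
  have hΓ2 : ∫ θ in Ioo 0 (π / 2), (angularWeight α θ / c) ^ 2 ≤ (π / 2) * (1 / c ^ 2) := by
    have hb : ∀ θ ∈ Ioo 0 (π / 2), (angularWeight α θ / c) ^ 2 ≤ 1 / c ^ 2 := by
      intro θ hθ
      have h0 : 0 ≤ angularWeight α θ := angularWeight_nonneg α (Ioo_subset_Icc_self hθ)
      have h1 : angularWeight α θ ≤ 1 := angularWeight_le_one hα (Ioo_subset_Icc_self hθ)
      rw [div_pow]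
      exact div_le_div_of_nonneg_right (pow_le_one₀ h0 h1) (by positivity)
    calc ∫ θ in Ioo 0 (π / 2), (angularWeight α θ / c) ^ 2
        ≤ ∫ θ in Ioo 0 (π / 2), (1 / c ^ 2 : ℝ) :=
          setIntegral_mono_on i1 (hI continuous_const) measurableSet_Ioo hb
      _ = (π / 2) * (1 / c ^ 2) := by
          rw [setIntegral_const, Real.volume_real_Ioo_of_le (by positivity), smul_eq_mul, sub_zero]
  -- numerics
  have hπ := Real.pi_lt_d4
  have hπ0 := Real.pi_gt_d2
  have hc2 : 1 / c ^ 2 ≤ 1 / (49 / 50 : ℝ) ^ 2 := by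
    apply one_div_le_one_div_of_le (by norm_num)
    exact pow_le_pow_left₀ (by norm_num) hc49 2
  nlinarith [hΓ2, hc2]

end Elgindi

end Literature.Analysis.FluidPDE
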